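import Summits.ValiantsHypothesis.ValiantsHypothesis.Theses.TwistedDetRank
import Summits.ValiantsHypothesis.ValiantsHypothesis.Theorems.TwistedDetRankTdrPerNotQP
import Summits.ValiantsHypothesis.ValiantsHypothesis.Theorems.TwistedDetRankFermionicNormalFormSummitHard
import HarnessLib

/-!
# Route TwistedDetRank — the crux `DirectSumExp` (stmt-ValiantsHypothesis-6285), PROVED

`DirectSumExp`: there is `c > 0` such that every representation of `per₃ ⊕ ⋯ ⊕ per₃` (the product
of the permanents of the `m` diagonal `3 × 3` blocks of the `(Fin m × Fin 3)`-indexed generic matrix)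
as a sum of `r` twisted determinants `det (E_t ∘ X)` of the full matrix has `2^{c m} ≤ r`. Proved with
`c = log₂ (3/2)`, i.e. `(3/2)^m ≤ r`, from LANDED lemmas of the route:

* transport along `finProdFinEquiv : Fin m × Fin 3 ≃ Fin (m·3)` (`rename_twistedDet`: a renamed
  twisted determinant is the twisted determinant of the transported twist; the block product becomes
  the "block family" `Σ_σ [σ is a block permutation] Π_j X_{σ j, j}`, `sum_blockIndicator_eq_prod`);
* coefficient extraction `repr_of_gmf_eq` (Theorems/TwistedDetRankFermionicNormalFormSummitHard) at the
  block permutations `σ_π = finProdFinEquiv.permCongr (prodCongrRight π)`, `π : Fin m → 𝔖₃`, together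
  with `coneRestriction_sign_blockPerm` / `coneRestriction_prod_blockPerm`
  (Theorems/TwistedDetRankTdrPerNotQPStubConeRestriction) gives a cone product decomposition of
  `sgn₃^{⊗m}` with `r` terms;
* the Kronecker/flattening bound `stub_conePowerRankThree`
  (Theorems/TwistedDetRankTdrPerNotQPStubConePowerRankThree): `3^m ≤ r · 2^m`.

Adapted from the strategist census artefact `Cruxes/FermionicNormalForm/Strengthen.lean`
(`directSumExp_candidate`, commit 0a6b2b5304e9, planner-cstrat seat; attached to the item as
evidence 2026-08), rewritten WITHOUT auxiliary definitions (the block permutation and the block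
indicator are spelled out) so that this file is theorems-only.

Honest framing: closes the crux `DirectSumExp` of route TwistedDetRank (the "exponential side" of the
direct-sum dichotomy, `R(m) ≥ (3/2)^m` for the Birkhoff-cone product rank of `sgn₃^{⊗m}`); the
route's other crux `FermionicNormalForm` (stmt-6283) stays OPEN, and nothing here is progress on
VP ≠ VNP.
-/

set_option linter.dupNamespace false

noncomputable section

namespace Summit.ValiantsHypothesis.ValiantsHypothesis.Theorems.TwistedDetRankDirectSumExpProof

open Equiv MvPolynomial Literature.Computability.AlgebraicComplexity
open Summit.ValiantsHypothesis.ValiantsHypothesis.Theses.TwistedDetRank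
open Summit.ValiantsHypothesis.ValiantsHypothesis.Theorems
open Summit.ValiantsHypothesis.ValiantsHypothesis.Theorems.TwistedDetRankTdrPerNotQP
open Summit.ValiantsHypothesis.ValiantsHypothesis.Theorems.TwistedDetRankFermionicNormalForm
open scoped BigOperators

/-! ### §1 Block permutations `σ_π = finProdFinEquiv.permCongr (prodCongrRight π)` of `Fin (m·3)` -/

/-- The block permutation of `π : Fin m → 𝔖₃` acts blockwise: `σ_π (e(b,i)) = e(b, π_b i)`,
`e = finProdFinEquiv`. [folklore] -/
theorem blockPerm_apply {m : ℕ} (π : Fin m → Perm (Fin 3)) (b : Fin m) (i : Fin 3) :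
    (finProdFinEquiv.permCongr (Equiv.prodCongrRight π)) (finProdFinEquiv (b, i)) =
      finProdFinEquiv (b, π b i) := by
  simp [Equiv.permCongr_apply]

/-- `π ↦ σ_π` is injective. [folklore] -/
theorem blockPerm_injective (m : ℕ) :
    Function.Injective fun π : Fin m → Perm (Fin 3) =>
      (finProdFinEquiv.permCongr (Equiv.prodCongrRight π) : Perm (Fin (m * 3))) := by
  intro π π' h
  funext b
  ext i
  have h1 := congrArg (fun σ : Perm (Fin (m * 3)) => σ (finProdFinEquiv (b, i))) h
  simp only [blockPerm_apply] at h1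
  have h2 := finProdFinEquiv.injective h1
  simp only [Prod.mk.injEq, true_and] at h2
  exact_mod_cast congrArg Fin.val h2

/-- Splitting a product over `Fin (m·3)` at a block permutation into blocks (any commutative monoid;
the landed `coneRestriction_prod_blockPerm` is the case `ℂ`). [folklore] -/
theorem prod_blockPerm {M : Type*} [CommMonoid M] {m : ℕ} (F : Fin (m * 3) → Fin (m * 3) → M)
    (π : Fin m → Perm (Fin 3)) :
    ∏ j, F ((finProdFinEquiv.permCongr (Equiv.prodCongrRight π)) j) j =
      ∏ b, ∏ i, F (finProdFinEquiv (b, π b i)) (finProdFinEquiv (b, i)) := by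
  rw [← finProdFinEquiv.prod_comp, Fintype.prod_prod_type]
  simp only [blockPerm_apply]

/-! ### §2 The block family is the product of the block permanents -/

/-- **`Σ_σ [σ = σ_π for some π] Π_j X(σ j, j) = Π_b Σ_{τ ∈ 𝔖₃} Π_i X(e(b, τ i), e(b, i))`**,
`e = finProdFinEquiv`: the generalised matrix function with the INDICATOR of the block permutations
as coefficient function is the product of the permanents of the `m` diagonal `3 × 3` blocks.
[folklore] -/
theorem sum_blockIndicator_eq_prod (m : ℕ) :
    (∑ σ : Perm (Fin (m * 3)),
        C (if σ ∈ Finset.univ.image (fun π : Fin m → Perm (Fin 3) =>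
              (finProdFinEquiv.permCongr (Equiv.prodCongrRight π) : Perm (Fin (m * 3))))
            then (1 : ℂ) else 0) *
          ∏ j : Fin (m * 3), (X (σ j, j) : MvPolynomial (Fin (m * 3) × Fin (m * 3)) ℂ)) =
      ∏ b : Fin m, ∑ τ : Perm (Fin 3), ∏ i : Fin 3,
        (X (finProdFinEquiv (b, τ i), finProdFinEquiv (b, i)) :
          MvPolynomial (Fin (m * 3) × Fin (m * 3)) ℂ) := by
  -- right-hand side: product of sums = sum over `π` of block products = sum of monomials of `σ_π`
  rw [Finset.prod_univ_sum]
  simp only [Fintype.piFinset_univ]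
  have hR : ∀ π : Fin m → Perm (Fin 3),
      (∏ b, ∏ i, (X (finProdFinEquiv (b, π b i), finProdFinEquiv (b, i)) :
          MvPolynomial (Fin (m * 3) × Fin (m * 3)) ℂ)) =
        ∏ j, (X ((finProdFinEquiv.permCongr (Equiv.prodCongrRight π)) j, j) :
          MvPolynomial (Fin (m * 3) × Fin (m * 3)) ℂ) := fun π =>
    (prod_blockPerm (fun a c => (X (a, c) : MvPolynomial (Fin (m * 3) × Fin (m * 3)) ℂ)) π).symm
  simp_rw [hR]
  -- left-hand side: the indicator kills everything outside the image, on which the map is injective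
  have hL : ∀ σ : Perm (Fin (m * 3)),
      C (if σ ∈ Finset.univ.image (fun π : Fin m → Perm (Fin 3) =>
            (finProdFinEquiv.permCongr (Equiv.prodCongrRight π) : Perm (Fin (m * 3))))
          then (1 : ℂ) else 0) *
        ∏ j : Fin (m * 3), (X (σ j, j) : MvPolynomial (Fin (m * 3) × Fin (m * 3)) ℂ) =
      if σ ∈ Finset.univ.image (fun π : Fin m → Perm (Fin 3) =>
            (finProdFinEquiv.permCongr (Equiv.prodCongrRight π) : Perm (Fin (m * 3)))) then
        ∏ j : Fin (m * 3), (X (σ j, j) : MvPolynomial (Fin (m * 3) × Fin (m * 3)) ℂ) else 0 := by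
    intro σ
    split_ifs <;> simp
  simp_rw [hL]
  rw [Finset.sum_ite_mem, Finset.univ_inter,
    Finset.sum_image fun π _ π' _ h => blockPerm_injective m h]

/-! ### §3 The cone product decomposition and the lower bound `3^m ≤ r · 2^m` -/

/-- **Lower bound for the block family**: if the block family is a sum of `r` twisted determinants,
then `3^m ≤ r · 2^m` — the diagonal `3 × 3` blocks of the twists give a cone product decomposition
of `sgn₃^{⊗m}` (`repr_of_gmf_eq` at the block permutations, `coneRestriction_sign_blockPerm`,
`coneRestriction_prod_blockPerm`) and `stub_conePowerRankThree` applies. [folklore] -/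
theorem block_lower_bound (m r : ℕ) (E : Fin r → Matrix (Fin (m * 3)) (Fin (m * 3)) ℂ)
    (h : (∑ σ : Perm (Fin (m * 3)),
        C (if σ ∈ Finset.univ.image (fun π : Fin m → Perm (Fin 3) =>
              (finProdFinEquiv.permCongr (Equiv.prodCongrRight π) : Perm (Fin (m * 3))))
            then (1 : ℂ) else 0) *
          ∏ j : Fin (m * 3), (X (σ j, j) : MvPolynomial (Fin (m * 3) × Fin (m * 3)) ℂ)) =
      ∑ t, (Matrix.of fun i j => C (E t i j) * X (i, j)).det) :
    3 ^ m ≤ r * 2 ^ m := by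
  refine stub_conePowerRankThree m r
    (fun t b i' i => E t (finProdFinEquiv (b, i')) (finProdFinEquiv (b, i))) fun π => ?_
  have hco := repr_of_gmf_eq _ E h (finProdFinEquiv.permCongr (Equiv.prodCongrRight π))
  rw [if_pos (Finset.mem_image_of_mem _ (Finset.mem_univ π))] at hco
  -- `hco : 1 = Σ_t sgn σ_π · Π_j E t (σ_π j) j`
  set s : ℂ := ((Perm.sign (finProdFinEquiv.permCongr (Equiv.prodCongrRight π) :
    Perm (Fin (m * 3))) : ℤ) : ℂ) with hs
  have hss : s * s = 1 := TwistedDetRankTdrSuperadditive.sign_mul_sign_self _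
  have hsgn : s = ∏ b, ((Perm.sign (π b) : ℤ) : ℂ) := coneRestriction_sign_blockPerm π
  have hprod : ∀ t, ∏ j, E t ((finProdFinEquiv.permCongr (Equiv.prodCongrRight π)) j) j =
      ∏ b, ∏ i, E t (finProdFinEquiv (b, π b i)) (finProdFinEquiv (b, i)) := fun t =>
    coneRestriction_prod_blockPerm (E t) π
  calc ∑ t, ∏ b, ∏ i, E t (finProdFinEquiv (b, π b i)) (finProdFinEquiv (b, i))
      = ∑ t, ∏ j, E t ((finProdFinEquiv.permCongr (Equiv.prodCongrRight π)) j) j :=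
        Finset.sum_congr rfl fun t _ => (hprod t).symm
    _ = s * s * ∑ t, ∏ j, E t ((finProdFinEquiv.permCongr (Equiv.prodCongrRight π)) j) j := by
        rw [hss, one_mul]
    _ = s * ∑ t, s * ∏ j, E t ((finProdFinEquiv.permCongr (Equiv.prodCongrRight π)) j) j := by
        rw [mul_assoc, Finset.mul_sum]
    _ = s * 1 := by rw [← hco]
    _ = ∏ b, ((Perm.sign (π b) : ℤ) : ℂ) := by rw [mul_one, hsgn]

/-! ### §4 Transport of twisted determinants along a relabelling -/

/-- Renaming a twisted determinant along `e × e` is the twisted determinant of the transported twist.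
[folklore] -/
theorem rename_twistedDet {ι : Type*} [Fintype ι] [DecidableEq ι] {n' : ℕ} (e : ι ≃ Fin n')
    (N : Matrix ι ι ℂ) :
    rename (Prod.map e e) ((Matrix.of fun p q => C (N p q) * (X (p, q) : MvPolynomial (ι × ι) ℂ)).det) =
      (Matrix.of fun i j => C (N (e.symm i) (e.symm j)) *
        (X (i, j) : MvPolynomial (Fin n' × Fin n') ℂ)).det := by
  rw [show (rename (Prod.map e e) : MvPolynomial (ι × ι) ℂ →ₐ[ℂ] MvPolynomial (Fin n' × Fin n') ℂ)
      ((Matrix.of fun p q => C (N p q) * (X (p, q) : MvPolynomial (ι × ι) ℂ)).det) =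
      ((rename (Prod.map e e) : MvPolynomial (ι × ι) ℂ →ₐ[ℂ] _).toRingHom.mapMatrix
        (Matrix.of fun p q => C (N p q) * (X (p, q) : MvPolynomial (ι × ι) ℂ))).det from
      RingHom.map_det _ _]
  rw [← Matrix.det_submatrix_equiv_self e]
  congr 1
  ext i j
  simp [Matrix.submatrix_apply, rename_X]

/-! ### §5 The crux -/

/-- **Crux `DirectSumExp` (stmt-ValiantsHypothesis-6285), PROVED** with `c = log₂ (3/2)`: every
representation of `per₃ ⊕ ⋯ ⊕ per₃` (`m` blocks) as a sum of `r` twisted determinants has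
`(2:ℝ)^(log₂(3/2) · m) = (3/2)^m ≤ r`. Transport to `Fin (m·3)` (`rename` along `finProdFinEquiv`,
`rename_twistedDet`), identify with the block family (`sum_blockIndicator_eq_prod`) and apply
`block_lower_bound`. [folklore] -/
theorem directSumExp_proof : DirectSumExp := by
  refine ⟨Real.logb 2 (3 / 2), Real.logb_pos one_lt_two (by norm_num), fun m r E hE => ?_⟩
  -- transport the representation to `Fin (m * 3)`
  have h' := congrArg (rename (Prod.map (finProdFinEquiv (m := m) (n := 3))
    (finProdFinEquiv (m := m) (n := 3)))) hE
  rw [map_sum] at h'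
  simp only [rename_twistedDet] at h'
  rw [map_prod] at h'
  simp only [map_sum, map_prod, rename_X, Prod.map_apply] at h'
  rw [← sum_blockIndicator_eq_prod] at h'
  have hlb := block_lower_bound m r _ h'
  -- `(3/2)^m ≤ r` as reals
  have h2 : (0 : ℝ) < 2 ^ m := pow_pos two_pos m
  have hreal : (3 : ℝ) ^ m ≤ r * 2 ^ m := by exact_mod_cast hlb
  rw [Real.rpow_mul (by norm_num : (0 : ℝ) ≤ 2), Real.rpow_logb two_pos (by norm_num) (by norm_num),
    Real.rpow_natCast, div_pow, div_le_iff₀ h2]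
  exact hreal

end Summit.ValiantsHypothesis.ValiantsHypothesis.Theorems.TwistedDetRankDirectSumExpProof

end
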